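import Mathlib
import Summits.ValiantsHypothesis.ValiantsHypothesis.Theorems.BarrierLeverPartitionMinorsHitByVPHiddenStatesMatchingPrep
import Summits.ValiantsHypothesis.ValiantsHypothesis.Theorems.BarrierLeverPartitionMinorsHitByVPSimplexJoinUniformSimplex
import Summits.ValiantsHypothesis.ValiantsHypothesis.Theorems.BarrierLeverPartitionMinorsHitByVPSimplexJoinUniform

/-!
# Route BarrierLever — item `PartitionMinorsHitByVP` (stmt-ValiantsHypothesis-19717), line `hidden_states`:
# THE MATCHING THEOREM, part 2/2 — matched pairs are free: a matching piece is good for EVERY row family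

Helper file (`--supports stmt-ValiantsHypothesis-19717`; cell valiant-natproofs, rung V4, 𝒟-side door (c); prover seat
val-np-p3 gen 20). Bookkeeping `structure IsMatching` (a Prop) and `def numPairs`. Closes NO item.
Memo HOME/val-np-p3/g20/MEMO-blockpeeling-valnp3-g20.md §5.

SETTING. One hidden-state piece with base point `0`, states `Fin K`, and a MATCHING FAMILY of columns
`cols : Fin r → Finset (Fin K)` (`IsMatching`: distinct columns, each a singleton or a pair of states, the pairs pairwise
disjoint, both states of a pair also present as singletons); its configuration matrix against a row family
`ℛ : Fin r → Finset (Fin h)` is `PairBlock.cfgMat ℛ cols g = [∏_{a ∈ ℛ i} Σ_{q ∈ cols k} g q a]`.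

**`exists_table_of_isMatching` (THE MATCHING THEOREM).** If `cols` has `p` pairs and `h + 3p ≤ r + 2` (at least `h − 2`
singleton columns beyond the pairs), then for EVERY injective family `ℛ` of `r` subsets of `Fin h` some table `g` makes the
configuration matrix nonsingular. This is the first result of the line in which structured (non-free, non-zeta) columns are
served for ALL row families: the `Δ` pair columns `{q, q'}` ride on generic tables exactly like free points, at the price of
`h − 2` free points of slack.

PROOF = BLOCK PEELING (induction on `p`): choose a pair `k₃ = {q₀, q₁}` with its singletons `k₁, k₂`; the three columns
`P = {k₁, k₂, k₃}` form the PAIR BLOCK. Since `r > h`, three rows are not a sunflower (`Matching.exists_not_sunflower3`), so by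
the TRIPLE LEMMA (`PairBlock.exists_table_triple`) a `0/1` table on `q₀, q₁` makes them a BASE (`GreedyCut.isBase_of_det_ne_zero`);
the other columns avoid `q₀, q₁` (`step_avoid`) and form a matching family with `p − 1` pairs (`step_rest`), so by induction and
`PairBlock.exists_common_table` ONE table on the other states is good for the complement of EVERY 3-set of rows; the GREEDY CUT
(`GreedyCut.exists_rowScale_det_ne_zero_of_bases`, weight `Σ_{a∈ℛ i} 2^a`, `SimplexJoin.binaryWeight_injective`) gives a scaling
`c`, realised by multiplying the states `q₀, q₁` by `c^{2^a}` in coordinate `a`. Base `p = 0`: generic points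
(`SimplexJoin.exists_points_det_ne_zero`).

STATUS. The matching family is NOT a threshold family (the pair graph of a threshold family is a threshold graph), so this does
not instantiate the registered node `stub_universalJoinWide`; it is the uniform-piece input for a GADGET door (memo §6) and the
template for the block-peeling programme (memo §7). Exhaustive numerics (all down-sets of `2^[5]`, `2^[6]`): the sharp condition is
`f₁(𝒰) ≤ K` (memo §5b). WHAT THIS IS NOT: item 19717 stays OPEN; nothing on crux 14610 or VP ≠ VNP.
-/

set_option linter.dupNamespace false

namespace Summit.ValiantsHypothesis.ValiantsHypothesis.Theorems.BarrierLever.HiddenStates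

open Finset Matrix

noncomputable section

namespace Matching

open PairBlock GreedyCut

variable {h K : ℕ}

/-! ## 3. Matching families -/

/-- A MATCHING FAMILY of columns of one zero-base piece: distinct columns, each a singleton or a pair of states; the pairs
pairwise disjoint; both states of a pair also occur as singleton columns. (States occurring in no column are allowed.) -/
structure IsMatching {r : ℕ} (cols : Fin r → Finset (Fin K)) : Prop where
  inj : Function.Injective cols
  card_mem : ∀ k, (cols k).card = 1 ∨ (cols k).card = 2
  single : ∀ k, (cols k).card = 2 → ∀ q ∈ cols k, ∃ k', cols k' = {q}
  disj : ∀ k k', (cols k).card = 2 → (cols k').card = 2 → k ≠ k' → Disjoint (cols k) (cols k')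

/-- The number of pair columns. -/
def numPairs {r : ℕ} (cols : Fin r → Finset (Fin K)) : ℕ :=
  (Finset.univ.filter fun k => (cols k).card = 2).card

/-- Base case: all columns are (distinct) singletons — generic points (`SimplexJoin.exists_points_det_ne_zero`). -/
theorem exists_table_of_numPairs_zero {r : ℕ} (cols : Fin r → Finset (Fin K)) (hM : IsMatching cols)
    (hp : numPairs cols = 0) (ℛ : Fin r → Finset (Fin h)) (hℛ : Function.Injective ℛ) :
    ∃ g : Fin K → Fin h → ℂ, (cfgMat ℛ cols g).det ≠ 0 := by
  classical
  have hone : ∀ k, (cols k).card = 1 := by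
    intro k
    rcases hM.card_mem k with h1 | h2
    · exact h1
    · exfalso
      rw [numPairs, Finset.card_eq_zero, Finset.filter_eq_empty_iff] at hp
      exact hp (Finset.mem_univ k) h2
  have hq : ∀ k, ∃ q : Fin K, cols k = {q} := fun k => Finset.card_eq_one.mp (hone k)
  choose q hq using hq
  have hqinj : Function.Injective q := fun k k' hkk' => hM.inj (by rw [hq, hq, hkk'])
  obtain ⟨z, hz⟩ := SimplexJoin.exists_points_det_ne_zero r h ℛ hℛ
  refine ⟨fun s a => if hs : ∃ k, q k = s then z (Classical.choose hs) a else 0, ?_⟩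
  have hmat : (cfgMat ℛ cols fun s a => if hs : ∃ k, q k = s then z (Classical.choose hs) a else 0) =
      Matrix.of fun x x' : Fin r => ∏ a ∈ ℛ x, z x' a := by
    refine Matrix.ext fun x x' => ?_
    simp only [cfgMat, Matrix.of_apply]
    refine Finset.prod_congr rfl fun a _ => ?_
    rw [hq x', Finset.sum_singleton]
    have hs : ∃ k, q k = q x' := ⟨x', rfl⟩
    rw [dif_pos hs]
    have : Classical.choose hs = x' := hqinj (Classical.choose_spec hs)
    rw [this]
  rw [hmat]
  exact hz

section Step

variable {r : ℕ} (cols : Fin r → Finset (Fin K)) (hM : IsMatching cols)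
  {k₁ k₂ k₃ : Fin r} {q₀ q₁ : Fin K} (hq : q₀ ≠ q₁)
  (hk₁ : cols k₁ = {q₀}) (hk₂ : cols k₂ = {q₁}) (hk₃ : cols k₃ = {q₀, q₁})

include hM hq hk₁ hk₂ hk₃

omit hM in
/-- The three columns of the chosen pair are distinct. -/
theorem step_distinct : k₁ ≠ k₂ ∧ k₁ ≠ k₃ ∧ k₂ ≠ k₃ := by
  refine ⟨fun h => hq ?_, fun h => ?_, fun h => ?_⟩
  · have := hk₁.symm.trans (h ▸ hk₂ : cols k₁ = {q₁})
    exact Finset.singleton_injective this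
  · have : (cols k₁).card = (cols k₃).card := by rw [h]
    rw [hk₁, hk₃, Finset.card_singleton, Finset.card_pair hq] at this
    exact absurd this (by norm_num)
  · have : (cols k₂).card = (cols k₃).card := by rw [h]
    rw [hk₂, hk₃, Finset.card_singleton, Finset.card_pair hq] at this
    exact absurd this (by norm_num)

/-- A column outside the chosen triple avoids both states of the pair. -/
theorem step_avoid {k : Fin r} (hk : k ≠ k₁) (hk' : k ≠ k₂) (hk'' : k ≠ k₃) : q₀ ∉ cols k ∧ q₁ ∉ cols k := by
  have key : ∀ {q : Fin K} {kq : Fin r}, cols kq = {q} → q ∈ cols k₃ → k ≠ kq → q ∉ cols k := by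
    intro q kq hkq hq3 hne hmem
    rcases hM.card_mem k with h1 | h2
    · obtain ⟨s, hs⟩ := Finset.card_eq_one.mp h1
      rw [hs, Finset.mem_singleton] at hmem
      subst hmem
      exact hne (hM.inj (hs.trans hkq.symm))
    · have hd := hM.disj k k₃ h2 (by rw [hk₃, Finset.card_pair hq]) hk''
      exact Finset.disjoint_left.mp hd hmem hq3
  exact ⟨key hk₁ (by rw [hk₃]; simp) hk, key hk₂ (by rw [hk₃]; simp) hk'⟩

omit hM hq in
/-- A column of the chosen triple lies inside the pair's states. -/
theorem step_sub {k : Fin r} (hk : k = k₁ ∨ k = k₂ ∨ k = k₃) : cols k ⊆ {q₀, q₁} := by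
  rcases hk with rfl | rfl | rfl
  · rw [hk₁]; exact Finset.singleton_subset_iff.mpr (by simp)
  · rw [hk₂]; exact Finset.singleton_subset_iff.mpr (by simp)
  · rw [hk₃]

/-- The remaining columns (outside the triple `P`, enumerated) again form a matching family, with one pair fewer. -/
theorem step_rest (P : Finset (Fin r)) (hP : P = {k₁, k₂, k₃}) {n' : ℕ} (hn' : Pᶜ.card = n') :
    IsMatching (fun y : Fin n' => cols (Pᶜ.orderEmbOfFin hn' y)) ∧
      numPairs (fun y : Fin n' => cols (Pᶜ.orderEmbOfFin hn' y)) + 1 = numPairs cols := by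
  classical
  obtain ⟨d12, d13, d23⟩ := step_distinct cols hq hk₁ hk₂ hk₃
  set emb := Pᶜ.orderEmbOfFin hn' with hemb
  have hmemc : ∀ y, emb y ∉ P := fun y => Finset.mem_compl.mp (Pᶜ.orderEmbOfFin_mem hn' y)
  have hne : ∀ y, emb y ≠ k₁ ∧ emb y ≠ k₂ ∧ emb y ≠ k₃ := by
    intro y
    have := hmemc y
    rw [hP] at this
    simp only [Finset.mem_insert, Finset.mem_singleton, not_or] at this
    exact this
  refine ⟨⟨fun y y' hyy' => emb.injective (hM.inj hyy'), fun y => hM.card_mem _, ?_, ?_⟩, ?_⟩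
  · intro y h2 q hqy
    obtain ⟨k', hk'⟩ := hM.single _ h2 q hqy
    -- `k'` is outside `P`
    have hav := step_avoid cols hM hq hk₁ hk₂ hk₃ (hne y).1 (hne y).2.1 (hne y).2.2
    have hk'P : k' ∉ P := by
      rw [hP]
      simp only [Finset.mem_insert, Finset.mem_singleton, not_or]
      refine ⟨fun h => hav.1 ?_, fun h => hav.2 ?_, fun h => ?_⟩
      · subst h; rw [hk₁] at hk'; rw [Finset.singleton_injective hk'.symm] at hqy; exact hqy
      · subst h; rw [hk₂] at hk'; rw [Finset.singleton_injective hk'.symm] at hqy; exact hqy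
      · subst h
        have : ({q} : Finset (Fin K)).card = 2 := by rw [← hk', hk₃, Finset.card_pair hq]
        simp at this
    obtain ⟨y', hy'⟩ : ∃ y', emb y' = k' := by
      have : k' ∈ Set.range emb := by rw [hemb, Finset.range_orderEmbOfFin]; exact Finset.mem_compl.mpr hk'P
      exact this
    exact ⟨y', by rw [hy']; exact hk'⟩
  · intro y y' h2 h2' hyy'
    exact hM.disj _ _ h2 h2' (fun h => hyy' (emb.injective h))
  · -- counting the pairs: those of `cols` are the pairs outside `P` plus `k₃`
    rw [numPairs, numPairs]
    have himg : (Finset.univ.filter fun y : Fin n' => (cols (emb y)).card = 2).image emb =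
        (Finset.univ.filter fun k : Fin r => (cols k).card = 2).erase k₃ := by
      ext k
      simp only [Finset.mem_image, Finset.mem_filter, Finset.mem_univ, true_and, Finset.mem_erase]
      constructor
      · rintro ⟨y, hy, rfl⟩
        exact ⟨(hne y).2.2, hy⟩
      · rintro ⟨hk3, hk2⟩
        have hkP : k ∉ P := by
          rw [hP]
          simp only [Finset.mem_insert, Finset.mem_singleton, not_or]
          refine ⟨fun h => ?_, fun h => ?_, hk3⟩
          · subst h; rw [hk₁, Finset.card_singleton] at hk2; exact absurd hk2 (by norm_num)
          · subst h; rw [hk₂, Finset.card_singleton] at hk2; exact absurd hk2 (by norm_num)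
        have : k ∈ Set.range emb := by rw [hemb, Finset.range_orderEmbOfFin]; exact Finset.mem_compl.mpr hkP
        obtain ⟨y, rfl⟩ := this
        exact ⟨y, hk2, rfl⟩
    have hk3mem : k₃ ∈ Finset.univ.filter fun k : Fin r => (cols k).card = 2 := by
      rw [Finset.mem_filter, hk₃, Finset.card_pair hq]; exact ⟨Finset.mem_univ _, rfl⟩
    rw [← Finset.card_image_of_injective _ emb.injective, himg, Finset.card_erase_of_mem hk3mem]
    have : 0 < (Finset.univ.filter fun k : Fin r => (cols k).card = 2).card := Finset.card_pos.mpr ⟨k₃, hk3mem⟩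
    omega

end Step

/-- **THE MATCHING THEOREM (zero base, every row family).** A matching family of columns with `p` pairs and the slack
`h + 3p ≤ r + 2` (i.e. at least `h − 2` singleton columns beyond the `3p` columns of the pairs) has, against EVERY injective family
of `r` monomials on `Fin h`, a table making its configuration matrix nonsingular. -/
theorem exists_table_of_isMatching : ∀ (p : ℕ) {r : ℕ} (cols : Fin r → Finset (Fin K)), IsMatching cols →
    numPairs cols = p → ∀ (ℛ : Fin r → Finset (Fin h)), Function.Injective ℛ → h + 3 * p ≤ r + 2 →
    ∃ g : Fin K → Fin h → ℂ, (cfgMat ℛ cols g).det ≠ 0 := by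
  classical
  intro p
  induction p with
  | zero => intro r cols hM hp ℛ hℛ _; exact exists_table_of_numPairs_zero cols hM hp ℛ hℛ
  | succ p ih =>
    intro r cols hM hp ℛ hℛ hslack
    -- a pair column `k₃ = {q₀, q₁}` and its singletons `k₁, k₂`
    have hne : (Finset.univ.filter fun k : Fin r => (cols k).card = 2).Nonempty := by
      rw [← Finset.card_pos]; rw [numPairs] at hp; omega
    obtain ⟨k₃, hk₃mem⟩ := hne
    rw [Finset.mem_filter] at hk₃mem
    obtain ⟨q₀, q₁, hq, hk₃⟩ := Finset.card_eq_two.mp hk₃mem.2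
    obtain ⟨k₁, hk₁⟩ := hM.single k₃ hk₃mem.2 q₀ (by rw [hk₃]; simp)
    obtain ⟨k₂, hk₂⟩ := hM.single k₃ hk₃mem.2 q₁ (by rw [hk₃]; simp)
    obtain ⟨d12, d13, d23⟩ := step_distinct cols hq hk₁ hk₂ hk₃
    set P : Finset (Fin r) := {k₁, k₂, k₃} with hPdef
    have hPcard : P.card = 3 := by
      rw [hPdef, Finset.card_insert_of_notMem (by simp [d12, d13]), Finset.card_pair d23]
    have hmemP : ∀ k, k ∈ P ↔ (k = k₁ ∨ k = k₂ ∨ k = k₃) := by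
      intro k; rw [hPdef]; simp
    have hr3 : 3 ≤ r := by
      have h1 : P.card ≤ r := by simpa using P.card_le_univ
      omega
    have hhr : h < r := by omega
    have hPc : Pᶜ.card = r - 3 := by rw [Finset.card_compl, Fintype.card_fin, hPcard]
    -- three rows that are not a sunflower, and the pair block's table on them
    obtain ⟨i, j, l, dij, dil, djl, hns⟩ := exists_not_sunflower3 ℛ hℛ hr3 hhr
    obtain ⟨g₂, hg₂⟩ := exists_table_triple (ℛ i) (ℛ j) (ℛ l) (fun h => dij (hℛ h)) (fun h => dil (hℛ h))
      (fun h => djl (hℛ h)) hns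
    -- the remaining columns: a matching family with `p` pairs; one table good for all complements of 3 rows
    set colsRest : Fin (r - 3) → Finset (Fin K) := fun y => cols (Pᶜ.orderEmbOfFin hPc y) with hcolsRest
    obtain ⟨hMrest, hprest⟩ := step_rest cols hM hq hk₁ hk₂ hk₃ P hPdef hPc
    have hprest' : numPairs colsRest = p := by rw [hcolsRest]; omega
    let T := {R : Finset (Fin r) // R.card = 3}
    have hRc : ∀ R : T, (R.1)ᶜ.card = r - 3 := fun R => by rw [Finset.card_compl, Fintype.card_fin, R.2]
    set fam : T → (Fin (r - 3) → Finset (Fin h)) := fun R y => ℛ ((R.1)ᶜ.orderEmbOfFin (hRc R) y) with hfam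
    have hgoodR : ∀ R : T, ∃ g : Fin K → Fin h → ℂ, (cfgMat (fam R) colsRest g).det ≠ 0 := by
      intro R
      refine ih colsRest hMrest hprest' (fam R) (fun y y' hyy' => ?_) (by omega)
      exact ((R.1)ᶜ.orderEmbOfFin (hRc R)).injective (hℛ hyy')
    obtain ⟨gR, hgR⟩ := exists_common_table fam colsRest hgoodR
    -- the combined table
    set g : Fin K → Fin h → ℂ := fun q a => if q = q₀ then g₂ 0 a else if q = q₁ then g₂ 1 a else gR q a with hgdef
    set N := cfgMat ℛ cols g with hN
    set wt : Fin r → ℕ := fun i => ∑ a ∈ ℛ i, 2 ^ (a : ℕ) with hwt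
    have hwtinj : Function.Injective wt := SimplexJoin.binaryWeight_injective ℛ hℛ
    -- columns outside `P` do not see the states `q₀, q₁`
    have hnotP : ∀ k, k ∉ P → k ≠ k₁ ∧ k ≠ k₂ ∧ k ≠ k₃ := by
      intro k hk
      have hk' : ¬ (k = k₁ ∨ k = k₂ ∨ k = k₃) := fun hh => hk ((hmemP k).mpr hh)
      obtain ⟨h1', h23'⟩ := not_or.mp hk'
      obtain ⟨h2', h3'⟩ := not_or.mp h23'
      exact ⟨h1', h2', h3'⟩
    have hsum_out : ∀ k, k ∉ P → ∀ a, (∑ q ∈ cols k, g q a) = ∑ q ∈ cols k, gR q a := by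
      intro k hk a
      obtain ⟨hk1', hk2', hk3'⟩ := hnotP k hk
      obtain ⟨h0, h1⟩ := step_avoid cols hM hq hk₁ hk₂ hk₃ hk1' hk2' hk3'
      refine Finset.sum_congr rfl fun q hqk => ?_
      have hq0 : q ≠ q₀ := fun hh => h0 (hh ▸ hqk)
      have hq1 : q ≠ q₁ := fun hh => h1 (hh ▸ hqk)
      show (if q = q₀ then g₂ 0 a else if q = q₁ then g₂ 1 a else gR q a) = gR q a
      rw [if_neg hq0, if_neg hq1]
    -- (hex): the rows `{i, j, l}` are a base for the block `P`
    have hex : ∃ R, IsBase N P R := by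
      set R₀ : Finset (Fin r) := {i, j, l} with hR₀
      have hR₀card : R₀.card = 3 := by
        rw [hR₀, Finset.card_insert_of_notMem (by simp [dij, dil]), Finset.card_pair djl]
      -- explicit equivalences `Fin 3 ≃ R₀`, `Fin 3 ≃ P`
      have hrow : ∀ x : Fin 3, (![i, j, l] : Fin 3 → Fin r) x ∈ R₀ := by
        intro x; fin_cases x <;> simp [hR₀]
      have hcol : ∀ x : Fin 3, (![k₁, k₂, k₃] : Fin 3 → Fin r) x ∈ P := by
        intro x; fin_cases x <;> simp [hPdef]
      have hrowinj : Function.Injective (fun x : Fin 3 => (⟨![i, j, l] x, hrow x⟩ : R₀)) := by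
        intro x x' hxx'
        exact injective_vec3 i j l dij dil djl (congrArg Subtype.val hxx')
      have hcolinj : Function.Injective (fun x : Fin 3 => (⟨![k₁, k₂, k₃] x, hcol x⟩ : P)) := by
        intro x x' hxx'
        exact injective_vec3 k₁ k₂ k₃ d12 d13 d23 (congrArg Subtype.val hxx')
      have hbijR : Function.Bijective (fun x : Fin 3 => (⟨![i, j, l] x, hrow x⟩ : R₀)) := by
        rw [Fintype.bijective_iff_injective_and_card]; exact ⟨hrowinj, by simp [hR₀card]⟩
      have hbijP : Function.Bijective (fun x : Fin 3 => (⟨![k₁, k₂, k₃] x, hcol x⟩ : P)) := by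
        rw [Fintype.bijective_iff_injective_and_card]; exact ⟨hcolinj, by simp [hPcard]⟩
      refine ⟨R₀, isBase_of_det_ne_zero N P R₀ (Equiv.ofBijective _ hbijR) (Equiv.ofBijective _ hbijP) ?_⟩
      have hmat : (Matrix.of fun x x' : Fin 3 =>
          N ((Equiv.ofBijective _ hbijR x : R₀) : Fin r) ((Equiv.ofBijective _ hbijP x' : P) : Fin r)) =
          cfgMat ![ℛ i, ℛ j, ℛ l] pairCols g₂ := by
        refine Matrix.ext fun x x' => ?_
        simp only [Matrix.of_apply, Equiv.ofBijective_apply, hN, cfgMat]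
        have hrows : ℛ ((![i, j, l] : Fin 3 → Fin r) x) = (![ℛ i, ℛ j, ℛ l] : Fin 3 → Finset (Fin h)) x := by
          fin_cases x <;> rfl
        rw [hrows]
        refine Finset.prod_congr rfl fun a _ => ?_
        fin_cases x'
        · simp [hk₁, pairCols, hgdef]
        · simp [hk₂, pairCols, hgdef, hq.symm]
        · simp [hk₃, pairCols, hgdef, Finset.sum_pair hq, hq.symm]
      rw [hmat]
      exact hg₂
    -- (hrest): every base has a nonsingular block-zeroed matrix
    have hrest : ∀ R, IsBase N P R → (blockZero N R P).det ≠ 0 := by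
      intro R hB
      have hRcard : R.card = 3 := hB.1.trans hPcard
      have hRc3 : Rᶜ.card = r - 3 := by rw [Finset.card_compl, Fintype.card_fin, hRcard]
      obtain ⟨er, herl, herr⟩ := exists_splitEquiv R hRcard hRc3
      obtain ⟨ec, hecl, hecr⟩ := exists_splitEquiv P hPcard hPc
      refine GreedyCut.det_blockZero_ne_zero N P R er ec
        (mem_iff_of_splitEquiv R hRcard hRc3 er herl herr) (mem_iff_of_splitEquiv P hPcard hPc ec hecl hecr) ?_ ?_
      · -- the block `R × P`: nonsingular since `R` is a base
        have hA := det_ne_zero_of_isBase N P R hB (R.orderIsoOfFin hRcard).toEquiv (P.orderIsoOfFin hPcard).toEquiv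
        have hmat : (Matrix.of fun x x' : Fin 3 => N (er (Sum.inl x)) (ec (Sum.inl x'))) =
            Matrix.of fun x x' : Fin 3 =>
              N ((R.orderIsoOfFin hRcard).toEquiv x : R) ((P.orderIsoOfFin hPcard).toEquiv x' : P) := by
          refine Matrix.ext fun x x' => ?_
          simp only [Matrix.of_apply, herl, hecl]
          rfl
        rw [hmat]; exact hA
      · -- the complementary block: the rest design on the complementary rows, where `g` agrees with `gR`
        have hmat : (Matrix.of fun y y' : Fin (r - 3) => N (er (Sum.inr y)) (ec (Sum.inr y'))) =
            cfgMat (fam ⟨R, hRcard⟩) colsRest gR := by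
          refine Matrix.ext fun y y' => ?_
          simp only [Matrix.of_apply, herr, hecr, hN, cfgMat, hfam, hcolsRest]
          refine Finset.prod_congr rfl fun a _ => ?_
          exact hsum_out _ (Finset.mem_compl.mp (Pᶜ.orderEmbOfFin_mem hPc y')) a
        rw [hmat]
        exact hgR ⟨R, hRcard⟩
    -- the greedy cut: some row-scaling of the `P`-columns is nonsingular — realised by scaling the states `q₀, q₁`
    obtain ⟨c, hc⟩ := exists_rowScale_det_ne_zero_of_bases N P wt hwtinj hex hrest
    refine ⟨fun q a => if q = q₀ ∨ q = q₁ then c ^ (2 ^ (a : ℕ)) * g q a else g q a, ?_⟩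
    have hmat : (cfgMat ℛ cols fun q a => if q = q₀ ∨ q = q₁ then c ^ (2 ^ (a : ℕ)) * g q a else g q a) =
        rowScale N P wt c := by
      refine Matrix.ext fun x k => ?_
      simp only [cfgMat, rowScale, Matrix.of_apply, hN]
      by_cases hk : k ∈ P
      · rw [if_pos hk]
        have hsub := step_sub cols hk₁ hk₂ hk₃ ((hmemP k).mp hk)
        have hin : ∀ q ∈ cols k, q = q₀ ∨ q = q₁ := by
          intro q hqk
          have := hsub hqk
          rw [Finset.mem_insert, Finset.mem_singleton] at this
          exact this
        have hfac : ∀ a : Fin h, (∑ q ∈ cols k, (if q = q₀ ∨ q = q₁ then c ^ (2 ^ (a : ℕ)) * g q a else g q a)) =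
            c ^ (2 ^ (a : ℕ)) * ∑ q ∈ cols k, g q a := by
          intro a
          rw [Finset.mul_sum]
          exact Finset.sum_congr rfl fun q hqk => by rw [if_pos (hin q hqk)]
        rw [Finset.prod_congr rfl fun a _ => hfac a, Finset.prod_mul_distrib, Finset.prod_pow_eq_pow_sum]
      · rw [if_neg hk]
        obtain ⟨hk1', hk2', hk3'⟩ := hnotP k hk
        obtain ⟨h0, h1⟩ := step_avoid cols hM hq hk₁ hk₂ hk₃ hk1' hk2' hk3'
        refine Finset.prod_congr rfl fun a _ => Finset.sum_congr rfl fun q hqk => ?_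
        have hq0 : q ≠ q₀ := fun hh => h0 (hh ▸ hqk)
        have hq1 : q ≠ q₁ := fun hh => h1 (hh ▸ hqk)
        rw [if_neg (not_or.mpr ⟨hq0, hq1⟩)]
    rw [hmat]
    exact hc

end Matching

end

end Summit.ValiantsHypothesis.ValiantsHypothesis.Theorems.BarrierLever.HiddenStates
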